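import Summits.ResolutionOfSingularities.ResolutionOfSingularities.Theorems.MarkedTransferCampaignW46TameSurfaceOrderReductionDimLE
import Literature.AlgebraicGeometry.Resolution.KollarSurfaceOrderReductionTameGlobal
import Literature.AlgebraicGeometry.Resolution.AlterationsMultisectionEtaleNhdChart
import HarnessLib

/-!
# [OURS · L1 W4.6, rung (iv) «large characteristic» ∩ rung (i) «surfaces»] In the regime
# `charGT n (fun _ b ↦ b) ∩ dimLE 2 ∩ singFinite` the characteristic-zero order reduction of a state of maximal order of the TYPED
# procedure is ONE smooth blow-up sequence on `Z` with empty final `Sing` (cell res-hironaka, LADDER-RESOLUTION rung L, D-0089; slot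
# W4.6, seat res-L1-s46-pv-7; host route MarkedTransfer, `--supports stmt-ResolutionOfSingularities-16155 --as helper`)

HONEST FRAMING. Nothing here is a statement of H. Hironaka's manuscript (2017-03-23, [Hironaka2017]) and nothing here
asserts that any statement of it holds. OURS corollaries, over the shared typed-procedure module
`MarkedTransferCampaignW46TypedProcedure` (res-L1-type-o1: `CampaignW46.Regime.charGT`, `Regime.dimLE`, `Regime.singFinite`,
`Regime.inter`; the manuscript enters only through the typed CANDIDATE carriers `AmbientDatum`, `IdealExponent`,
`IdealExponent.sing`, used as definitions), of this seat's Literature file `KollarSurfaceOrderReductionTameGlobal.lean`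
(p552004: GLOBAL order reduction for marked ideals `(𝓘, ∅, b)` with `max-ord 𝓘 ≤ b < p` and finite cosupport of closed
points of dimension `≤ 2` on a scheme smooth over a perfect field — the local resolutions glued by extension and
concatenation, `BlowupSequencesExtendOpen.lean`, `BlowupSequencesOffCentres.lean`). No premise of the manuscript, no
FACT-LIST premise. AI review is weaker than expert review. No `sorry`, no new definition; axioms standard.

## What this file pins

* **`exists_isResolutionOf_of_charGT_dimLE_singFinite`** — for a state `(A, E)`, `E = (J, b)`, over a PERFECT field `K`
  of characteristic `p`, in the regime `charGT n (fun _ b ↦ b) ∩ dimLE 2 ∩ singFinite` («`p > b`», «`dim Z ≤ 2`»,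
  «`Sing(E)` finite»), with `1 ≤ b` and `J` of maximal order `b`: there is a smooth blow-up sequence ON `Z` which RESOLVES
  the marked ideal `(Z, J, ∅, b)` in the sense of BGMW Def. 3.1.3 (`CentreSeq.IsResolutionOf`: regular centres inside the
  successive `Sing`, simple normal crossings with the exceptional boundary, EMPTY final `Sing`) — the honest `C` for
  surfaces with isolated singular points is the order `b`, globally;
* `exists_isResolutionOf_of_le_dimLE_singFinite` — the same in every regime `charGT n f ∩ dimLE 2 ∩ singFinite` with
  `(fun _ b ↦ b) ≤ f`.

What is NOT here: states whose `Sing` has a curve component (locally one blowing up of that curve,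
`KollarSurfaceOrderReductionTameLocal.lean`; the global first step is not written), `dim Z ≥ 3`, and the identification
of the produced `CentreSeq` with a typed `Run` (the blow-ups `blowup C` are the tree's chosen models).

## References (context; nothing is cited as a premise)

* J. Kollár, *Lectures on Resolution of Singularities* (2007), Thm. 3.69, 3.105 — through this seat's Literature files.
  [cite: Kollar2007, Thm. 3.69]
* E. Bierstone, D. Grigoriev, P. Milman, J. Włodarczyk (2011), Def. 3.1.3, Thm. 8.0.4.
  [cite: BierstoneGrigorievMilmanWlodarczyk2011, Thm. 8.0.4]
-/

noncomputable section

set_option linter.dupNamespace false -- mandated namespace of this single-conjunct summit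

open CategoryTheory AlgebraicGeometry TopologicalSpace IsLocalRing

namespace Summit.ResolutionOfSingularities.ResolutionOfSingularities.Theorems
namespace CampaignW46
namespace TameSurfaceOrderReduction

open Literature.AlgebraicGeometry.Resolution
open Literature.AlgebraicGeometry.Hironaka2017.S02Preliminaries

universe u

variable {n : ℕ} {p : ℕ} [Fact p.Prime] {K : Type u} [Field K] [CharP K p]

/-- [OURS · L1 W4.6 (iv) ∩ (i); NOT a statement of the manuscript] **In the regime
`charGT n (fun _ b ↦ b) ∩ dimLE 2 ∩ singFinite`, the characteristic-zero order reduction of every state of maximal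
order is ONE smooth blow-up sequence on `Z`.** For `(A, E)`, `E = (J, b)`, over a perfect field `K` of characteristic
`p`, with `b < p`, `dim Z ≤ 2`, `Sing(E)` finite, `1 ≤ b` and `ord_ξ J ≤ b` everywhere: there is `s : CentreSeq Z`
RESOLVING `(Z, J, ∅, b)` (admissible regular centres in the successive `Sing`, snc with the exceptional boundary, final
`Sing` empty). `Sing(E)` is closed (`= V(MC(J))`, tame) and finite, hence consists of closed points (`Z` is Jacobson),
each of dimension `≤ dim Z ≤ 2`; instance of `Kollar2007.exists_isResolutionOf_of_finite_support_of_topologicalKrullDim_le_two`.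
[cite: Kollar2007, Thm. 3.69] -/
theorem exists_isResolutionOf_of_charGT_dimLE_singFinite [PerfectField K] (A : AmbientDatum p K)
    (E : IdealExponent A.Z)
    (hE : Regime.inter (Regime.inter (Regime.charGT (p := p) (K := K) n (fun _ b => b)) (Regime.dimLE 2))
      Regime.singFinite A E)
    (hb : 1 ≤ E.b) (hmax : ∀ ξ : A.Z, idealOrder E.J ξ ≤ E.b) :
    ∃ s : CentreSeq A.Z, s.IsResolutionOf ⟨E.J, [], E.b⟩ := by
  letI : A.Z.Over (Spec (.of K)) := ⟨A.hom⟩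
  haveI : Smooth (A.Z ↘ Spec (.of K)) := A.smooth
  have hbp : E.b < p := hE.1.1
  have hdim : topologicalKrullDim A.Z ≤ 2 := hE.1.2
  have hfin : E.sing.Finite := hE.2
  haveI : JacobsonSpace A.Z := LocallyOfFiniteType.jacobsonSpace (A.Z ↘ Spec (.of K))
  have hclosed : IsClosed E.sing := by
    rw [TameMaximalContact.sing_eq_support,
      Kollar2007.support_marked_eq_support_maxContactIdealSheaf K A.Z p E.J hb (Or.inr hbp.le)]
    exact (Scheme.IdealSheafData.support _).isClosed
  have hcl : ∀ ξ ∈ E.sing, IsClosed ({ξ} : Set A.Z) := fun ξ hξ =>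
    isClosed_singleton_of_mem_finite hclosed hfin hξ
  exact Kollar2007.exists_isResolutionOf_of_finite_support_of_topologicalKrullDim_le_two K A.Z p hdim E.J hb
    (Or.inr hbp) hmax (by rw [← TameMaximalContact.sing_eq_support]; exact hfin)
    (by rw [← TameMaximalContact.sing_eq_support]; exact hcl)

/-- [OURS · L1 W4.6 (iv) ∩ (i)] The same in every regime `charGT n f ∩ dimLE 2 ∩ singFinite` whose threshold dominates the
order, `(fun _ b ↦ b) ≤ f` (e.g. `fun _ b ↦ b !`), by `Regime.charGT_of_le` (p471737). [cite: Kollar2007, Thm. 3.69] -/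
theorem exists_isResolutionOf_of_le_dimLE_singFinite [PerfectField K] {f : ℕ → ℕ → ℕ} (hf : (fun _ b : ℕ => b) ≤ f)
    (A : AmbientDatum p K) (E : IdealExponent A.Z)
    (hE : Regime.inter (Regime.inter (Regime.charGT (p := p) (K := K) n f) (Regime.dimLE 2)) Regime.singFinite A E)
    (hb : 1 ≤ E.b) (hmax : ∀ ξ : A.Z, idealOrder E.J ξ ≤ E.b) :
    ∃ s : CentreSeq A.Z, s.IsResolutionOf ⟨E.J, [], E.b⟩ :=
  exists_isResolutionOf_of_charGT_dimLE_singFinite A E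
    ⟨⟨Regime.charGT_of_le (fun b => hf n b) A E hE.1.1, hE.1.2⟩, hE.2⟩ hb hmax

/-- [OURS · L1 W4.6 (iv) ∩ (i)] **Reading of the conclusion**: for the sequence produced above, every centre is regular,
lies in the current order-`≥ b` locus and has simple normal crossings with the exceptional divisors created so far, and
the order-`≥ b` locus (`IdealExponent.sing`) of the final controlled transform is EMPTY (BGMW Def. 3.1.3 (1)–(2), (6)).
[cite: BierstoneGrigorievMilmanWlodarczyk2011, Def. 3.1.3] -/
theorem sing_final_eq_empty_of_charGT_dimLE_singFinite [PerfectField K] (A : AmbientDatum p K)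
    (E : IdealExponent A.Z)
    (hE : Regime.inter (Regime.inter (Regime.charGT (p := p) (K := K) n (fun _ b => b)) (Regime.dimLE 2))
      Regime.singFinite A E)
    (hb : 1 ≤ E.b) (hmax : ∀ ξ : A.Z, idealOrder E.J ξ ≤ E.b) :
    ∃ s : CentreSeq A.Z, s.IsAdmissibleFor ⟨E.J, [], E.b⟩ ∧
      (IdealExponent.sing ⟨(s.transformMarked ⟨E.J, [], E.b⟩).ideal, (s.transformMarked ⟨E.J, [], E.b⟩).mult⟩ :
        Set s.top) = ∅ := by
  obtain ⟨s, hs⟩ := exists_isResolutionOf_of_charGT_dimLE_singFinite A E hE hb hmax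
  exact ⟨s, sing_transform_eq_empty hs⟩

end TameSurfaceOrderReduction
end CampaignW46
end Summit.ResolutionOfSingularities.ResolutionOfSingularities.Theorems

end
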